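import Summits.AtomisticToContinuum.HydrodynamicLimit.Theorems.CollisionIsometryCLTCollisionalTransferLocalityRhsAConst
import Summits.AtomisticToContinuum.HydrodynamicLimit.Theorems.CollisionIsometryCLTCollisionalTransferLocalityKfunAConst
import Summits.AtomisticToContinuum.HydrodynamicLimit.Theorems.CollisionIsometryCLTCollisionalTransferLocalityConeLLNConst
import Summits.AtomisticToContinuum.HydrodynamicLimit.Theorems.CollisionIsometryCLTCollisionalTransferLocalityRhsAConeConst
import Summits.AtomisticToContinuum.HydrodynamicLimit.Theorems.CollisionIsometryCLTCollisionalTransferLocalityKfunAConeConst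
import Summits.AtomisticToContinuum.HydrodynamicLimit.Theorems.CollisionIsometryCLTCollisionalTransferLocalityTwoScaleValueARung0
import HarnessLib

/-!
# The EQUILIBRIUM ∀ θ : ℝ, 0 < θ → ∃ σ₀ : ℝ, 0 < σ₀ ∧ ∃ η₁ : ℝ, 0 < η₁ ∧ ∀ σ : ℝ, 0 < σ → σ < σ₀ → ∀ (Φ : Flows σ) (t : ℝ), 0 < t → ∀ (γ C : ℝ) (φ : ℕ → T3 → ℝ), 0 < γ → γ ≤ 1 / 15 → AdmissibleKernel γ C φ → DiluteAt σ (fun _ => 1) (fun _ => θ) (fun _ => 0) Φ t φ η₁ → ∀ (A : ℝ → T3 → Fin 3 → Fin 3 → ℝ), SmoothMatrixOn (Icc 0 t) A → ∀ τ ∈ Icc 0 t, ∀ η δ : ℝ, 0 < η → 0 < δ → ∃ r₀ : ℝ, 0 < r₀ ∧ ∀ r : ℝ, 0 < r → r < r₀ → ∃ N₀ : ℕ, ∀ N : ℕ, N₀ ≤ N → Literature.MathematicalPhysics.KineticTheory.localGibbsLaw σ (fun _ => 1) (fun _ => 0) (fun _ => θ) N (Φ N) {z | η < |(RhsA σ Φ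 (fun (_ : ℕ) (y : T3) => Literature.MathematicalPhysics.KineticTheory.coneKernel r y 0) A N z τ + KfunA σ Φ (fun (_ : ℕ) (y : T3) => Literature.MathematicalPhysics.KineticTheory.coneKernel r y 0) A N z τ) - (RhsA σ Φ φ A N z τ + KfunA σ Φ φ A N z τ)|} ≤ ENNReal.ofReal δ of the two-scale engine statement [TS] — unconditionally
(line `hemisphere-affine-slaving`, crux `CollisionalTransferLocality`, stmt-AtomisticToContinuum-9518; registered helper `twoScaleValueA_rung0`)

ASSEMBLY (seat c10, skeleton composition 5). The text of the research stub [TS] `stub_twoScaleValueA` (= `TwoScaleValueRegularity`, …DefsF)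
at the CONSTANT profiles `a₀ ≡ 1`, `θ₀ ≡ θ`, `u₀ ≡ 0` is a THEOREM: under the homogeneous local Gibbs law, for every flow family, `t > 0`,
admissible mesoscale kernel family, smooth matrix weight `A` on `[0, t]`, `τ ≤ t`, `η, δ > 0`, for all `r < 1/4` and `N ≥ N₀`:
`P(η < |(RhsA + KfunA)[b_r](τ) − (RhsA + KfunA)[φ_N](τ)|) ≤ δ` — both value functionals tend to the common deterministic limit
`θ(Z(σ³) − 1)∫₀^τ∫ tr A` ([R0A] `stub_rhsA_const`, [R0C] `stub_rhsA_cone_const` fed with [C0L] `stub_coneLLNConst`) and both kinetic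
corrections to `0` ([K0A] `stub_kfunA_const`, [K0C] `stub_kfunA_cone_const`), assembled by [TS0] `stub_twoScaleValueA_rung0`. This certifies the
normalisation of [TS] (a wrong constant in either value functional would contradict it). [folklore]
-/

namespace Summit.AtomisticToContinuum.HydrodynamicLimit.Theorems.HemisphereAffineSlaving

open scoped BigOperators Topology Classical ENNReal InnerProductSpace
open Filter Set Function MeasureTheory

noncomputable section

open Literature.MathematicalPhysics.KineticTheory (T3 V3)

/-- **Registered helper `twoScaleValueA_rung0`: the equilibrium rung of [TS]**, unconditionally. -/
theorem twoScaleValueA_rung0 : ∀ θ : ℝ, 0 < θ → ∃ σ₀ : ℝ, 0 < σ₀ ∧ ∃ η₁ : ℝ, 0 < η₁ ∧ ∀ σ : ℝ, 0 < σ → σ < σ₀ → ∀ (Φ : Flows σ) (t : ℝ), 0 < t → ∀ (γ C : ℝ) (φ : ℕ → T3 → ℝ), 0 < γ → γ ≤ 1 / 15 → AdmissibleKernel γ C φ → DiluteAt σ (fun _ => 1) (fun _ => θ) (fun _ => 0) Φ t φ η₁ → ∀ (A : ℝ → T3 → Fin 3 → Fin 3 → ℝ), SmoothMatrixOn (Icc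 0 t) A → ∀ τ ∈ Icc 0 t, ∀ η δ : ℝ, 0 < η → 0 < δ → ∃ r₀ : ℝ, 0 < r₀ ∧ ∀ r : ℝ, 0 < r → r < r₀ → ∃ N₀ : ℕ, ∀ N : ℕ, N₀ ≤ N → Literature.MathematicalPhysics.KineticTheory.localGibbsLaw σ (fun _ => 1) (fun _ => 0) (fun _ => θ) N (Φ N) {z | η < |(RhsA σ Φ (fun (_ : ℕ) (y : T3) => Literature.MathematicalPhysics.KineticTheory.coneKernel r y 0) A N z τ + KfunA σ Φ (fun (_ : ℕ) (y : T3) => Literature.MathematicalPhysics.KineticTheory.coneKernel r y 0) A N z τ) - (RhsA σ Φ φ A N z τ + KfunA σ Φ φ A N z τ)|} ≤ ENNReal.ofReal δ :=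
  stub_twoScaleValueA_rung0 stub_rhsA_const stub_kfunA_const (stub_rhsA_cone_const stub_coneLLNConst) stub_kfunA_cone_const

end

end Summit.AtomisticToContinuum.HydrodynamicLimit.Theorems.HemisphereAffineSlaving
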